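import Mathlib
import HarnessLib
import Summits.HubbardSuperconductivity.HubbardSuperconductivity.Theorems.KLProgrammeKLRegimeVolumeLimitLastScaleCommonFrameDoor
import Summits.HubbardSuperconductivity.HubbardSuperconductivity.Theorems.KLProgrammeKLRegimeTwoVolumeDualMomentumReadout
import Summits.HubbardSuperconductivity.HubbardSuperconductivity.Theses.KLProgramme

/-!
# Route `KLProgramme` — crux K3, VL child `KLRegimeVolumeLimitV17F2` (stmt-HubbardSuperconductivity-20440): THE REGISTERED STUB TEXT FROM A
# COMMON-FRAME DUAL ROW DEFECT ALONE (leg (ii) discharged by k3c4-p2's exact last-scale frame change)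
# (cell gate-hubbard-kl, seat hubbard-kl-k3c5-p3 g9, technique «OS-positivity-free direct assembly»)

Composition of k3c4-p2 g9's `…VolumeLimitLastScaleCommonFrameDoor.framedNestedFlowTextV17F2_of_commonFrame_bounded` (stub text ⟸ unit framed partition function of
the FINE volume at the COARSE frame + (i) common-frame two-volume comparison + a one-volume bound `B`; leg (ii) = exact algebra `…TwoVolumeLastScaleFrameExact`)
with this seat's dual read-out `…TwoVolumeDualMomentumReadout` (`norm_klSelfEnergy_sub_le_frame_add_dualDefect` at `Kc = Kf = K_L`: frame term `≡ 0`;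
`norm_selfEnergy_le_dualRows`; `klSelfEnergy_eq_eval_add_selfEnergy_sub_counter`) and the tower's frame sup bound `abs_eval_klFlowFrameU_le_of_towerV17F2`:

* **`framedNestedFlowTextV17F2_of_commonFrameDualDefect`** — stub text ⟸ «per Matsubara integer ∃ L₀ δ→0 B: for L ≥ L₀, L″ = b·L, eventually in M, ∃ pins
  o_c o_f, at every label of that integer: IsUnit Z_{L″}^{n⋆}(K_L) ∧ 2ε·(Ddef₊ + Dfar₊) ≤ δ L ∧ 2ε·Σ_y ‖R_L(o_c;y)‖ ≤ B» — rows of `𝒱_L[K_L] − 𝒩_{K_L}` and of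
  `𝒱_{L″}[K_L] − 𝒩_{K_L}` (BOTH volumes at the coarse frame `K_L = klFlowFrameU L M β U μ (n_β+1)`), dual currency, NO resummation, NO symbol term;
* `volumeLimitTextV17F2_of_commonFrameDualDefect`, and the by-workitem closer **`KLRegimeVolumeLimitV17F2_of_commonFrameDualDefect`**.

Proofs only; no definition.  References: BGM 2006 §2.4 (2.38); FST 1996 §1.
-/

noncomputable section

namespace Summit.HubbardSuperconductivity.HubbardSuperconductivity.Theorems.TwoPointAssembly

set_option linter.dupNamespace false -- summit = problem name (single-conjunct summit), D-0017

open Finset Filter Topology Complex Literature.MathematicalPhysics.QuantumLattice Literature.Probability.LatticeModels GrassmannAlgebra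
open Summit.HubbardSuperconductivity.HubbardSuperconductivity.Theorems.KLRegimeSplit
open Summit.HubbardSuperconductivity.HubbardSuperconductivity.Theorems.KLProgrammeLegKernels
open Summit.HubbardSuperconductivity.HubbardSuperconductivity.Theorems.TwoVolumeDefect

/-- **THE STUB TEXT FROM A COMMON-FRAME DUAL ROW DEFECT ALONE.**  See the module docstring. [cite: BenfattoGiulianiMastropietro2006, §2.4 (2.38)] -/
theorem framedNestedFlowTextV17F2_of_commonFrameDualDefect
    (hD : ∀ (G : GeoConsts) (P : SplitConsts) (Q : EngConsts) (R : RenConsts), G.WF → P.WF → Q.WF → R.WF →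
      ∃ c₅ : ℝ, 0 < c₅ ∧ ∀ c : ℝ, 0 < c → c ≤ c₅ → ∃ U₀ : ℝ, 0 < U₀ ∧
        ∀ μ ∈ klWindowC, ∀ U : ℝ, 0 < U → U ≤ U₀ → ∀ β : ℝ, klBetaMin ≤ β → β ≤ Real.exp (c / U ^ 2) →
          ∀ K : TrigPolyC4v, klPredsV17F2.frameOK R U (nScales β) μ K →
            ∀ (Lstar : ℕ) (Mstar : ℕ → ℕ), TowerP klPredsV17F2 G P Q R β U μ K Lstar Mstar →
              ∀ n : ℤ, ∃ L₀ : ℕ, ∃ δ : ℕ → ℝ, ∃ B : ℝ, Tendsto δ atTop (𝓝 0) ∧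
                ∀ (L : ℕ) [NeZero L], L₀ ≤ L → ∀ (L'' : ℕ) [NeZero L''] (b : ℕ), L'' = b * L → ∃ M₀ : ℕ, ∀ (M : ℕ) [NeZero M], M₀ ≤ M →
                  ∃ (oc : SpaceTimeIdx L M) (of : SpaceTimeIdx L'' M), ∀ ω : MatsubaraIdx M, matsubaraInt M ω = n →
                    IsUnit (effPartitionFn ℂ
                        (normalCovariance L'' M (uvSymbolCT L'' M β μ (klFlowFrameU L M β U μ (nScales β + 1)) (klScale klE0 (nScales β + 1))))
                        (hubbardInteraction L'' M β U + counterQuadratic L'' M β (klFlowFrameU L M β U μ (nScales β + 1)))) ∧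
                    2 * imagTimeWeight β M *
                      ((∑ ybar : TorusSite 2 L,
                          ‖(∑ t₁ : ImagTimeIdx M,
                              sectorisedKernel L M β (trivialMultiplier L M)
                                  (klEffectiveAction L M β U μ (klFlowFrameU L M β U μ (nScales β + 1)) klE0 (nScales β + 1) -
                                    counterQuadratic L M β (klFlowFrameU L M β U μ (nScales β + 1))) 2
                                  (![((0, 0), 0), ((0, 0), 1)] : Fin 2 → SectorLeg 1) ![oc, (t₁, oc.2 + ybar)] *
                                Complex.exp (((matsubaraFreq β M ω * (imagTime β M oc.1 - imagTime β M t₁) : ℝ) : ℂ) * I)) -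
                            (∑ t₁ : ImagTimeIdx M,
                              sectorisedKernel L'' M β (trivialMultiplier L'' M)
                                  (klEffectiveAction L'' M β U μ (klFlowFrameU L M β U μ (nScales β + 1)) klE0 (nScales β + 1) -
                                    counterQuadratic L'' M β (klFlowFrameU L M β U μ (nScales β + 1))) 2
                                  (![((0, 0), 0), ((0, 0), 1)] : Fin 2 → SectorLeg 1) ![of, (t₁, of.2 + Torus.proj L'' (Torus.cRep ybar))] *
                                Complex.exp (((matsubaraFreq β M ω * (imagTime β M of.1 - imagTime β M t₁) : ℝ) : ℂ) * I))‖) +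
                        ∑ y ∈ univ.filter (fun y : TorusSite 2 L'' => Torus.proj L'' (Torus.cRep (fun i => (((y i).val : ℕ) : ZMod L))) ≠ y),
                          ‖∑ t₁ : ImagTimeIdx M,
                              sectorisedKernel L'' M β (trivialMultiplier L'' M)
                                  (klEffectiveAction L'' M β U μ (klFlowFrameU L M β U μ (nScales β + 1)) klE0 (nScales β + 1) -
                                    counterQuadratic L'' M β (klFlowFrameU L M β U μ (nScales β + 1))) 2
                                  (![((0, 0), 0), ((0, 0), 1)] : Fin 2 → SectorLeg 1) ![of, (t₁, of.2 + y)] *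
                                Complex.exp (((matsubaraFreq β M ω * (imagTime β M of.1 - imagTime β M t₁) : ℝ) : ℂ) * I)‖) ≤ δ L ∧
                    2 * imagTimeWeight β M *
                      ∑ y : TorusSite 2 L,
                        ‖∑ t₁ : ImagTimeIdx M,
                            sectorisedKernel L M β (trivialMultiplier L M)
                                (klEffectiveAction L M β U μ (klFlowFrameU L M β U μ (nScales β + 1)) klE0 (nScales β + 1) -
                                  counterQuadratic L M β (klFlowFrameU L M β U μ (nScales β + 1))) 2
                                (![((0, 0), 0), ((0, 0), 1)] : Fin 2 → SectorLeg 1) ![oc, (t₁, oc.2 + y)] *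
                              Complex.exp (((matsubaraFreq β M ω * (imagTime β M oc.1 - imagTime β M t₁) : ℝ) : ℂ) * I)‖ ≤ B) :
    ∀ (G : GeoConsts) (P : SplitConsts) (Q : EngConsts) (R : RenConsts), G.WF → P.WF → Q.WF → R.WF →
      ∃ c₅ : ℝ, 0 < c₅ ∧ ∀ c : ℝ, 0 < c → c ≤ c₅ → ∃ U₀ : ℝ, 0 < U₀ ∧
        ∀ μ ∈ klWindowC, ∀ U : ℝ, 0 < U → U ≤ U₀ → ∀ β : ℝ, klBetaMin ≤ β → β ≤ Real.exp (c / U ^ 2) →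
          ∀ K : TrigPolyC4v, klPredsV17F2.frameOK R U (nScales β) μ K →
            ∀ (Lstar : ℕ) (Mstar : ℕ → ℕ), TowerP klPredsV17F2 G P Q R β U μ K Lstar Mstar →
              ∀ n : ℤ, ∃ L₀ : ℕ, ∃ ρ : ℕ → ℝ, Tendsto ρ atTop (𝓝 0) ∧
                ∀ (L : ℕ) [NeZero L], L₀ ≤ L → ∀ (L'' : ℕ) [NeZero L''], L ∣ L'' → ∃ M₀ : ℕ, ∀ (M : ℕ) [NeZero M], M₀ ≤ M →
                  ∀ (ω : MatsubaraIdx M), matsubaraInt M ω = n → ∀ (k : TorusSite 2 L) (k'' : TorusSite 2 L''),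
                    latticeMomentum L'' k'' = latticeMomentum L k →
                      ‖klSelfEnergy L M β U μ (klFlowFrameU L M β U μ (nScales β + 1)) klE0 (nScales β + 1) (ω, k) 0 -
                          klSelfEnergy L'' M β U μ (klFlowFrameU L'' M β U μ (nScales β + 1)) klE0 (nScales β + 1) (ω, k'') 0‖ ≤ ρ L := by
  refine framedNestedFlowTextV17F2_of_commonFrame_bounded ?_
  intro G P Q R hG hP hQ hR
  obtain ⟨c₅, hc₅, hc⟩ := hD G P Q R hG hP hQ hR
  refine ⟨c₅, hc₅, fun c hc0 hcc => ?_⟩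
  obtain ⟨U₀, hU₀, hU⟩ := hc c hc0 hcc
  refine ⟨U₀, hU₀, fun μ hμ U hU0 hUU β hβmin hβmax K hK Lstar Mstar hT n => ?_⟩
  have hβ : 0 < β := pos_of_klBetaMin_le hβmin
  obtain ⟨L₀, δ, B, hδ, hDn⟩ := hU μ hμ U hU0 hUU β hβmin hβmax K hK Lstar Mstar hT n
  -- the frame sup bound from the tower
  set Kmax : ℝ := ∑ m ∈ range (nScales β + 1), R.Gfr 0 * uPow 0 U * (4 : ℝ) ^ ((((0 : ℕ) : ℤ) - 2) * (m : ℤ)) with hKmax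
  refine ⟨max L₀ Lstar, δ, Kmax + B, hδ, fun L _ hL L'' _ hdvd => ?_⟩
  obtain ⟨b, hb⟩ := hdvd
  have hb' : L'' = b * L := by rw [hb, mul_comm]
  have hL₀ : L₀ ≤ L := (le_max_left _ _).trans hL
  have hLs : Lstar ≤ L := (le_max_right _ _).trans hL
  obtain ⟨M₀, hM₀⟩ := hDn L hL₀ L'' b hb'
  refine ⟨max M₀ (Mstar L), fun M _ hM ω hω k k'' hk => ?_⟩
  have hMM₀ : M₀ ≤ M := (le_max_left _ _).trans hM
  have hM₁ : Mstar L ≤ M := (le_max_right _ _).trans hM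
  obtain ⟨oc, of, hw⟩ := hM₀ M hMM₀
  obtain ⟨hZ, hdef, hB⟩ := hw ω hω
  refine ⟨hZ, ?_, ?_⟩
  · -- leg (i): common-frame dual read-out (the frame term vanishes)
    have hi := norm_klSelfEnergy_sub_le_frame_add_dualDefect hb' hβ U μ (klFlowFrameU L M β U μ (nScales β + 1))
      (klFlowFrameU L M β U μ (nScales β + 1)) (nScales β + 1) ω 0 oc of hk
    rw [sub_self, abs_zero, zero_add] at hi
    exact hi.trans hdef
  · -- the one-volume bound: `Σ[𝒱[K]] = K(p) + Σ[𝒱[K] − 𝒩_K]`, `|K(p)| ≤ Kmax`, the rest by the dual rows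
    rw [klSelfEnergy_eq_eval_add_selfEnergy_sub_counter hβ.ne' U μ _ (nScales β + 1) (ω, k) 0]
    refine (norm_add_le _ _).trans (add_le_add ?_ ?_)
    · rw [Complex.norm_real, Real.norm_eq_abs]
      exact abs_eval_klFlowFrameU_le_of_towerV17F2 hT hLs hM₁ le_rfl _
    · exact (norm_selfEnergy_le_dualRows hβ _ ω 0 (rows_baseIndependent_klEffectiveAction_sub_counter hβ.ne' U μ _ _ ω 0) oc k).trans hB

/-- **The VL child text from a common-frame dual row defect alone** (∘ `volumeLimitTextV17F2_of_framedNestedFlowText`). [cite: BenfattoGiulianiMastropietro2006, §2.4 (2.38)] -/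
theorem volumeLimitTextV17F2_of_commonFrameDualDefect
    (hD : ∀ (G : GeoConsts) (P : SplitConsts) (Q : EngConsts) (R : RenConsts), G.WF → P.WF → Q.WF → R.WF →
      ∃ c₅ : ℝ, 0 < c₅ ∧ ∀ c : ℝ, 0 < c → c ≤ c₅ → ∃ U₀ : ℝ, 0 < U₀ ∧
        ∀ μ ∈ klWindowC, ∀ U : ℝ, 0 < U → U ≤ U₀ → ∀ β : ℝ, klBetaMin ≤ β → β ≤ Real.exp (c / U ^ 2) →
          ∀ K : TrigPolyC4v, klPredsV17F2.frameOK R U (nScales β) μ K →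
            ∀ (Lstar : ℕ) (Mstar : ℕ → ℕ), TowerP klPredsV17F2 G P Q R β U μ K Lstar Mstar →
              ∀ n : ℤ, ∃ L₀ : ℕ, ∃ δ : ℕ → ℝ, ∃ B : ℝ, Tendsto δ atTop (𝓝 0) ∧
                ∀ (L : ℕ) [NeZero L], L₀ ≤ L → ∀ (L'' : ℕ) [NeZero L''] (b : ℕ), L'' = b * L → ∃ M₀ : ℕ, ∀ (M : ℕ) [NeZero M], M₀ ≤ M →
                  ∃ (oc : SpaceTimeIdx L M) (of : SpaceTimeIdx L'' M), ∀ ω : MatsubaraIdx M, matsubaraInt M ω = n →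
                    IsUnit (effPartitionFn ℂ
                        (normalCovariance L'' M (uvSymbolCT L'' M β μ (klFlowFrameU L M β U μ (nScales β + 1)) (klScale klE0 (nScales β + 1))))
                        (hubbardInteraction L'' M β U + counterQuadratic L'' M β (klFlowFrameU L M β U μ (nScales β + 1)))) ∧
                    2 * imagTimeWeight β M *
                      ((∑ ybar : TorusSite 2 L,
                          ‖(∑ t₁ : ImagTimeIdx M,
                              sectorisedKernel L M β (trivialMultiplier L M)
                                  (klEffectiveAction L M β U μ (klFlowFrameU L M β U μ (nScales β + 1)) klE0 (nScales β + 1) -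
                                    counterQuadratic L M β (klFlowFrameU L M β U μ (nScales β + 1))) 2
                                  (![((0, 0), 0), ((0, 0), 1)] : Fin 2 → SectorLeg 1) ![oc, (t₁, oc.2 + ybar)] *
                                Complex.exp (((matsubaraFreq β M ω * (imagTime β M oc.1 - imagTime β M t₁) : ℝ) : ℂ) * I)) -
                            (∑ t₁ : ImagTimeIdx M,
                              sectorisedKernel L'' M β (trivialMultiplier L'' M)
                                  (klEffectiveAction L'' M β U μ (klFlowFrameU L M β U μ (nScales β + 1)) klE0 (nScales β + 1) -
                                    counterQuadratic L'' M β (klFlowFrameU L M β U μ (nScales β + 1))) 2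
                                  (![((0, 0), 0), ((0, 0), 1)] : Fin 2 → SectorLeg 1) ![of, (t₁, of.2 + Torus.proj L'' (Torus.cRep ybar))] *
                                Complex.exp (((matsubaraFreq β M ω * (imagTime β M of.1 - imagTime β M t₁) : ℝ) : ℂ) * I))‖) +
                        ∑ y ∈ univ.filter (fun y : TorusSite 2 L'' => Torus.proj L'' (Torus.cRep (fun i => (((y i).val : ℕ) : ZMod L))) ≠ y),
                          ‖∑ t₁ : ImagTimeIdx M,
                              sectorisedKernel L'' M β (trivialMultiplier L'' M)
                                  (klEffectiveAction L'' M β U μ (klFlowFrameU L M β U μ (nScales β + 1)) klE0 (nScales β + 1) -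
                                    counterQuadratic L'' M β (klFlowFrameU L M β U μ (nScales β + 1))) 2
                                  (![((0, 0), 0), ((0, 0), 1)] : Fin 2 → SectorLeg 1) ![of, (t₁, of.2 + y)] *
                                Complex.exp (((matsubaraFreq β M ω * (imagTime β M of.1 - imagTime β M t₁) : ℝ) : ℂ) * I)‖) ≤ δ L ∧
                    2 * imagTimeWeight β M *
                      ∑ y : TorusSite 2 L,
                        ‖∑ t₁ : ImagTimeIdx M,
                            sectorisedKernel L M β (trivialMultiplier L M)
                                (klEffectiveAction L M β U μ (klFlowFrameU L M β U μ (nScales β + 1)) klE0 (nScales β + 1) -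
                                  counterQuadratic L M β (klFlowFrameU L M β U μ (nScales β + 1))) 2
                                (![((0, 0), 0), ((0, 0), 1)] : Fin 2 → SectorLeg 1) ![oc, (t₁, oc.2 + y)] *
                              Complex.exp (((matsubaraFreq β M ω * (imagTime β M oc.1 - imagTime β M t₁) : ℝ) : ℂ) * I)‖ ≤ B) :
    VolumeLimitP2 klPredsV17F2 FinalTwoLegVolLimitEx klWindowC :=
  volumeLimitTextV17F2_of_framedNestedFlowText (framedNestedFlowTextV17F2_of_commonFrameDualDefect hD)

/-- **The rev-22 VL child `KLRegimeVolumeLimitV17F2` (stmt-…-20440) from a common-frame dual row defect alone** (by-`--workitem` closer).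
[cite: BenfattoGiulianiMastropietro2006, §2.4 (2.38)] -/
theorem KLRegimeVolumeLimitV17F2_of_commonFrameDualDefect
    (hD : ∀ (G : GeoConsts) (P : SplitConsts) (Q : EngConsts) (R : RenConsts), G.WF → P.WF → Q.WF → R.WF →
      ∃ c₅ : ℝ, 0 < c₅ ∧ ∀ c : ℝ, 0 < c → c ≤ c₅ → ∃ U₀ : ℝ, 0 < U₀ ∧
        ∀ μ ∈ klWindowC, ∀ U : ℝ, 0 < U → U ≤ U₀ → ∀ β : ℝ, klBetaMin ≤ β → β ≤ Real.exp (c / U ^ 2) →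
          ∀ K : TrigPolyC4v, klPredsV17F2.frameOK R U (nScales β) μ K →
            ∀ (Lstar : ℕ) (Mstar : ℕ → ℕ), TowerP klPredsV17F2 G P Q R β U μ K Lstar Mstar →
              ∀ n : ℤ, ∃ L₀ : ℕ, ∃ δ : ℕ → ℝ, ∃ B : ℝ, Tendsto δ atTop (𝓝 0) ∧
                ∀ (L : ℕ) [NeZero L], L₀ ≤ L → ∀ (L'' : ℕ) [NeZero L''] (b : ℕ), L'' = b * L → ∃ M₀ : ℕ, ∀ (M : ℕ) [NeZero M], M₀ ≤ M →
                  ∃ (oc : SpaceTimeIdx L M) (of : SpaceTimeIdx L'' M), ∀ ω : MatsubaraIdx M, matsubaraInt M ω = n →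
                    IsUnit (effPartitionFn ℂ
                        (normalCovariance L'' M (uvSymbolCT L'' M β μ (klFlowFrameU L M β U μ (nScales β + 1)) (klScale klE0 (nScales β + 1))))
                        (hubbardInteraction L'' M β U + counterQuadratic L'' M β (klFlowFrameU L M β U μ (nScales β + 1)))) ∧
                    2 * imagTimeWeight β M *
                      ((∑ ybar : TorusSite 2 L,
                          ‖(∑ t₁ : ImagTimeIdx M,
                              sectorisedKernel L M β (trivialMultiplier L M)
                                  (klEffectiveAction L M β U μ (klFlowFrameU L M β U μ (nScales β + 1)) klE0 (nScales β + 1) -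
                                    counterQuadratic L M β (klFlowFrameU L M β U μ (nScales β + 1))) 2
                                  (![((0, 0), 0), ((0, 0), 1)] : Fin 2 → SectorLeg 1) ![oc, (t₁, oc.2 + ybar)] *
                                Complex.exp (((matsubaraFreq β M ω * (imagTime β M oc.1 - imagTime β M t₁) : ℝ) : ℂ) * I)) -
                            (∑ t₁ : ImagTimeIdx M,
                              sectorisedKernel L'' M β (trivialMultiplier L'' M)
                                  (klEffectiveAction L'' M β U μ (klFlowFrameU L M β U μ (nScales β + 1)) klE0 (nScales β + 1) -
                                    counterQuadratic L'' M β (klFlowFrameU L M β U μ (nScales β + 1))) 2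
                                  (![((0, 0), 0), ((0, 0), 1)] : Fin 2 → SectorLeg 1) ![of, (t₁, of.2 + Torus.proj L'' (Torus.cRep ybar))] *
                                Complex.exp (((matsubaraFreq β M ω * (imagTime β M of.1 - imagTime β M t₁) : ℝ) : ℂ) * I))‖) +
                        ∑ y ∈ univ.filter (fun y : TorusSite 2 L'' => Torus.proj L'' (Torus.cRep (fun i => (((y i).val : ℕ) : ZMod L))) ≠ y),
                          ‖∑ t₁ : ImagTimeIdx M,
                              sectorisedKernel L'' M β (trivialMultiplier L'' M)
                                  (klEffectiveAction L'' M β U μ (klFlowFrameU L M β U μ (nScales β + 1)) klE0 (nScales β + 1) -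
                                    counterQuadratic L'' M β (klFlowFrameU L M β U μ (nScales β + 1))) 2
                                  (![((0, 0), 0), ((0, 0), 1)] : Fin 2 → SectorLeg 1) ![of, (t₁, of.2 + y)] *
                                Complex.exp (((matsubaraFreq β M ω * (imagTime β M of.1 - imagTime β M t₁) : ℝ) : ℂ) * I)‖) ≤ δ L ∧
                    2 * imagTimeWeight β M *
                      ∑ y : TorusSite 2 L,
                        ‖∑ t₁ : ImagTimeIdx M,
                            sectorisedKernel L M β (trivialMultiplier L M)
                                (klEffectiveAction L M β U μ (klFlowFrameU L M β U μ (nScales β + 1)) klE0 (nScales β + 1) -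
                                  counterQuadratic L M β (klFlowFrameU L M β U μ (nScales β + 1))) 2
                                (![((0, 0), 0), ((0, 0), 1)] : Fin 2 → SectorLeg 1) ![oc, (t₁, oc.2 + y)] *
                              Complex.exp (((matsubaraFreq β M ω * (imagTime β M oc.1 - imagTime β M t₁) : ℝ) : ℂ) * I)‖ ≤ B) :
    Summit.HubbardSuperconductivity.HubbardSuperconductivity.Theses.KLProgramme.KLRegimeVolumeLimitV17F2 := by
  show VolumeLimitP2 klPredsV17F2 FinalTwoLegVolLimitEx klWindowC
  exact volumeLimitTextV17F2_of_commonFrameDualDefect hD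

end Summit.HubbardSuperconductivity.HubbardSuperconductivity.Theorems.TwoPointAssembly
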